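import Summits.Ventures.QEC.Census.CertCheckBZAutSem
import Summits.Ventures.QEC.Census.BB.BB144.BZAutCoverTabZ
import Summits.Ventures.QEC.Theorems.BB144DistanceCertificateLowerZ
import Literature.InformationTheory.QuantumCodes.HypergraphProductKernels
import HarnessLib

/-!
# `[[144,12,12]]` KERNEL-std programme — `LowerZSem`: the lower bound from the FIFTEEN representative blocks of the
# `bz_aut` certificate `7c1e929a…` (`BB144.bzAutData`), LANE-AGNOSTIC (director-qec g2 R15/R16 (e), R17)

`Theorems/BB144DistanceCertificateLowerZ.lean` / `…LowerZKernel.lean` (qec-type-10) assemble the bound from the 15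
blocks' BZ-ENUMERATION verdicts (`cert.bzZBlock bzAutData b = true`). Lane β (qec-search-9 g2) certifies the same 15
blocks by MEET-IN-THE-MIDDLE in the kernel (`Census/CertCheckBZMitm*.lean`), concluding per block the SEMANTIC bound
«every non-trivial flat `Z`-logical whose label lies in `span W_b` has weight `> 10`». This file states the assembly
with that semantic per-block hypothesis (type-10 `bzAut_lower_sound_sem`), the KERNEL label cover (type-12
`coverAutTabOK_bb144`) and the 72 translation transports, standard axioms only:

  `twelve_le_flat_of_blockBounds15 : (∀ b < 15, BLOCK BOUND b) → ∀ w, HXFlat w = 0 → w ∉ rowspace HZFlat → 12 ≤ |w|`.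

The KERNEL-std closer is then `BB.bb144.zLowerBound_of_flat rfl rfl (twelve_le_flat_of_blockBounds15 hblock)` +
`closes`, with `hblock b` from β's `block_sound_mitm` (or from α-lane KERNEL enumeration files through
`blockBound15_of_bzZBlock`).
-/

namespace Summit.Ventures.QEC.Census.BB144

open Matrix Literature.InformationTheory.QuantumCodes Literature.InformationTheory.QuantumCodes.BB
  Summit.Ventures.QEC.BB

/-! ## Reused from `LowerZ` (qec-type-10, p475993): `core_ok`, `logZ_ok`, `len_ok`, `foundZ_ok`, `flatCode`, `sigmaInv`, `LXmat`,
`LZmat`, `LX_mul_LZ_transpose`; KERNEL cover from type-12. -/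

/-! ## Assembly -/

/-- **`LowerZSem`, lane-agnostic**: if each of the fifteen representative blocks satisfies its SEMANTIC bound (every
non-trivial flat `Z`-logical with label in `span W_b` has weight `> 10`), then every non-trivial flat `Z`-logical of
the certificate's code has weight `> 11`. Standard axioms. -/
theorem lowerZ15_of_blockBounds
    (hblock : ∀ (b : Fin bzAutData.sideZ.blocks.length) (z : Fin cert.n → ZMod 2),
      rowMatrix cert.n cert.HX *ᵥ z = 0 → z ∉ rowSpace (rowMatrix cert.n cert.HZ) →
      ldMat cert.n bzAutData.LZ bzAutData.LX *ᵥ z ∈ Submodule.span (ZMod 2)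
        (Set.range fun l : Fin (bzAutData.sideZ.blocks[b]).W.length =>
          ofBits bzAutData.LZ.length (bzAutData.sideZ.blocks[b]).W[l]) →
      10 < hammingNorm z)
    (w : Fin cert.n → ZMod 2) (hw : rowMatrix cert.n cert.HX *ᵥ w = 0)
    (hw' : w ∉ rowSpace (rowMatrix cert.n cert.HZ)) : 11 < hammingNorm w := by
  -- structural facts unpacked once
  have hcore := core_ok
  simp only [bzCoreOK, Bool.and_eq_true, beq_iff_eq] at hcore
  obtain ⟨⟨⟨⟨hY, hS⟩, hL⟩, hdim⟩, -⟩ := hcore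
  -- the label-action ingredients
  have hLX : ∀ a, flatCode.HZ *ᵥ LXmat a = 0 := fun a => mulVec_dual_eq_zero hL a
  have hexp : ∀ z, flatCode.HX *ᵥ z = 0 → z - (LXmat *ᵥ z) ᵥ* LZmat ∈ flatCode.rowSpZ := fun z hz =>
    flatCode.sub_label_vecMul_mem_rowSpZ hLX LX_mul_LZ_transpose (exists_coeffs_of_ker comm_flat hY hS hL hdim hz)
  refine bzAut_lower_sound_sem (s := bzAutData.sideZ) (wmax := 11) comm_flat core_ok
    (fun b z hz hz' hlab => ?_)
    (α := {t : Mono 12 6 // (((t.1 : Fin 12) : ℕ), ((t.2 : Fin 6) : ℕ)) ∈ allTranslations})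
    (fun a z => z ∘ sigmaInv a.1)
    (fun a => LXmat * (LZmat.submatrix id (sigmaInv a.1))ᵀ)
    (fun a z hz hz' => ?_) (fun lam hlam => ?_) w hw hw'
  · -- the semantic block bound, parity-adjusted threshold `wEff 11 (some _) = 10`
    exact hblock b z hz hz' hlab
  · -- transport by the translation `a.1`
    have hXsub : flatCode.HX.submatrix (BB.checkTranslateFlat a.1) (BB.translateFlat a.1) = flatCode.HX := by
      have h := BB.HXFlat_submatrix_translateFlat BB.bb144 a.1
      rw [← HX_eq_flat] at h
      exact h
    have hZsub : flatCode.HZ.submatrix (BB.checkTranslateFlat a.1) (BB.translateFlat a.1) = flatCode.HZ := by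
      have h := BB.HZFlat_submatrix_translateFlat BB.bb144 a.1
      rw [← HZ_eq_flat] at h
      exact h
    obtain ⟨h1, h2⟩ := flatCode.zLogical_comp_equiv_symm_of_rowMap hXsub hZsub ⟨hz, hz'⟩
    exact ⟨h1, h2, hammingNorm_comp_equiv z (BB.translateFlat a.1 : Fin cert.n ≃ Fin cert.n),
      flatCode.label_comp_equiv_symm hLX hexp hZsub hz⟩
  · -- cover by translates (KERNEL table)
    rcases coverAutTabOK_sound (ℓ := 12) (m := 6) coverAutTabOK_bb144
        (P := fun μ => ∃ b : Fin bzAutData.sideZ.blocks.length, μ ∈ Submodule.span (ZMod 2)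
          (Set.range fun l : Fin (bzAutData.sideZ.blocks[b]).W.length =>
            ofBits bzAutData.LZ.length (bzAutData.sideZ.blocks[b]).W[l]))
        (fun v hv => testBit_coverMask_imp_exists_span _ _ hv)
        (Ld' := LXmat) (L' := LZmat) (fun i => rfl)
        (fun j => by
          change ofBits cert.n bzAutData.LZ[j] = ofBits cert.n (bzAutData.LZ.getD j 0)
          rw [List.getD_eq_getElem?_getD, List.getElem?_eq_getElem j.2, Option.getD_some]
          rfl)
        lam hlam with hP | ⟨t, ht, hPt⟩
    · exact Or.inl hP
    · obtain ⟨b, hb⟩ := hPt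
      exact Or.inr ⟨⟨t, ht⟩, b, hb⟩

/-- **`LowerZSem` on the typed code's flat matrices** (`BB.bb144.HXFlat/HZFlat`, the shape `zLowerBound_of_flat rfl rfl`
and type-12's `bb144_d_eq_of_forall_lt_flat` consume): fifteen semantic block bounds ⇒ every non-trivial flat
`Z`-logical has weight `≥ 12`. Standard axioms. -/
theorem twelve_le_flat_of_blockBounds15
    (hblock : ∀ (b : Fin bzAutData.sideZ.blocks.length) (z : Fin cert.n → ZMod 2),
      rowMatrix cert.n cert.HX *ᵥ z = 0 → z ∉ rowSpace (rowMatrix cert.n cert.HZ) →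
      ldMat cert.n bzAutData.LZ bzAutData.LX *ᵥ z ∈ Submodule.span (ZMod 2)
        (Set.range fun l : Fin (bzAutData.sideZ.blocks[b]).W.length =>
          ofBits bzAutData.LZ.length (bzAutData.sideZ.blocks[b]).W[l]) →
      10 < hammingNorm z)
    (w : Fin (12 * 6 + 12 * 6) → ZMod 2) (hw : BB.bb144.HXFlat *ᵥ w = 0) (hw' : w ∉ rowSpace BB.bb144.HZFlat) :
    12 ≤ hammingNorm w := by
  rw [← HX_eq_flat] at hw
  rw [← HZ_eq_flat] at hw'
  exact lowerZ15_of_blockBounds hblock w hw hw'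

/-! ## The α-lane adapter: a block's BZ-enumeration verdict gives its semantic bound
(composing it with `twelve_le_flat_of_blockBounds15` re-derives `twelve_le_flat_of_blocks` of `LowerZKernel`) -/

/-- **α-lane adapter**: block `b`'s Bool verdict `cert.bzZBlock bzAutData b = true` (assembled from the emitted
`bzZSys`/`bzZEnum`/`bzZBound` parts by `DistCert.bzZBlock_of_parts`) gives block `b`'s semantic bound. -/
theorem blockBound15_of_bzZBlock (b : Fin bzAutData.sideZ.blocks.length) (hb : cert.bzZBlock bzAutData b = true)
    (z : Fin cert.n → ZMod 2) (hz : rowMatrix cert.n cert.HX *ᵥ z = 0) (hz' : z ∉ rowSpace (rowMatrix cert.n cert.HZ))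
    (hlab : ldMat cert.n bzAutData.LZ bzAutData.LX *ᵥ z ∈ Submodule.span (ZMod 2)
      (Set.range fun l : Fin (bzAutData.sideZ.blocks[b]).W.length =>
        ofBits bzAutData.LZ.length (bzAutData.sideZ.blocks[b]).W[l])) :
    10 < hammingNorm z := by
  have hlen := len_ok
  simp only [DistCert.bzZLen, bzLenOK, List.all_eq_true] at hlen
  have h := blockBound_of_bzBlockOK (wmax := cert.dZ - 1) (found := cert.sideZ.found) comm_flat foundZ_ok core_ok b
    (by rw [List.all_eq_true]; exact hlen _ (List.getElem_mem b.2)) hb z hz hz' hlab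
  exact h

end Summit.Ventures.QEC.Census.BB144
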